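import Mathlib
import Summits.Ventures.PercRepro2.Defs
import Summits.Ventures.PercRepro2.Harris
import Summits.Ventures.PercRepro2.CoinDefs
import Summits.Ventures.PercRepro2.CoinStarDefs
import Summits.Ventures.PercRepro2.CoinLsmCoreDefs
import Summits.Ventures.PercRepro2.CoinLsmCoreU
import Summits.Ventures.PercRepro2.CoinCoreGate
import Summits.Ventures.PercRepro2.CoinOrTailKDefs
import Summits.Ventures.PercRepro2.CoinOrTailKSums
import Summits.Ventures.PercRepro2.CoinOrTailLsmCore
import Summits.Ventures.PercRepro2.CoinTreeCore
import Summits.Ventures.PercRepro2.CoinKSureCore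
import Summits.Ventures.PercRepro2.CoinKSureTailSums
import Summits.Ventures.PercRepro2.CoinKSureGen

import Summits.Ventures.PercRepro2.CoinKSureCloseStar
/-!
# Two level reductions: the OR-tail `a` over `U` and a sure OR-vertex `b` over `U ∪ {a}`
(blind cell PercRepro2, night-2 g15; proofs/NIGHT2-DARC.md §53)

The core sums over `U ∪ {a, b}` of `ClosedInCoreU.phiC_gate_eq` reduce, first through `b`
(`sum_gen` / `sum_gen_tail` over the core `U ∪ {a}`, the sure-coin mixture being the OR-closure
`closeB entb b A`), then through `a` (over `U`), to sums over `U` of `rValK (closeB entb b A)` /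
`gValK (closeB entb b A)` — with the marker at `b` becoming the entry indicator `entInd entb`
(`two_level_R`, `two_level_R_tail`, `two_level_G`, `two_level_G_tail`).
-/

namespace Summit.Ventures.PercRepro2.Coin

open Classical

section TwoLevel

variable {V : Type*} {E : Type*} [DecidableEq V] [Fintype E] [DecidableEq E]
  {R : Type*} [Field R]
  {arcs : E → Finset (V × V)} {s : V} {U : Finset V} {ent : Finset V} {c : V → E} {a w : V}
  {entb : Finset V} {d : V → E} {b : V}

/-- **Two level reductions, `R`-side, a marker constant in `a` and `b`.** -/
lemma two_level_R (h : OrTailK arcs s U ent c a) (hb : OrTailK arcs s (insert a U) entb d b)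
    (pr : E → R) (hsureb : ∀ r ∈ entb, pr (d r) = 1) (A m : Finset V → R)
    (hmb : ∀ W, m (insert b W) = m W) (hma : ∀ W, m (insert a W) = m W) :
    ∑ W ∈ (insert b (insert a U)).powerset,
        prob pr (coreLevel arcs s (insert b (insert a U)) W) * A W * m W =
      ∑ W ∈ U.powerset, prob pr (coreLevel arcs s U W) *
        rValK (closeB entb b A) pr ent c a W * m W := by
  rw [hb.sum_gen pr A m hmb]
  have step : ∀ W ∈ (insert a U).powerset, prob pr (coreLevel arcs s (insert a U) W) *
      (tailWtK pr entb d W * A W + (1 - tailWtK pr entb d W) * A (W ∪ {b})) * m W =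
      prob pr (coreLevel arcs s (insert a U) W) * closeB entb b A W * m W := by
    intro W _
    rw [closeB_of_sure pr d b A hsureb W]
  rw [Finset.sum_congr rfl step, h.sum_gen pr (closeB entb b A) m hma]
  rfl

/-- **Two level reductions, `R`-side, the marker at `b`** (times a marker constant in `a`, `b`). -/
lemma two_level_R_tail (h : OrTailK arcs s U ent c a)
    (hb : OrTailK arcs s (insert a U) entb d b) (hae : a ∉ entb)
    (pr : E → R) (hsureb : ∀ r ∈ entb, pr (d r) = 1) (A g m : Finset V → R)
    (hg0 : ∀ W, b ∉ W → g W = 0) (hg1 : ∀ W, b ∉ W → g (insert b W) = m W)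
    (hma : ∀ W, m (insert a W) = m W) :
    ∑ W ∈ (insert b (insert a U)).powerset,
        prob pr (coreLevel arcs s (insert b (insert a U)) W) * A W * g W =
      ∑ W ∈ U.powerset, prob pr (coreLevel arcs s U W) *
        rValK (closeB entb b A) pr ent c a W * (entInd entb W * m W) := by
  rw [hb.sum_gen_tail pr A g m hg0 hg1]
  have step : ∀ W ∈ (insert a U).powerset, prob pr (coreLevel arcs s (insert a U) W) *
      ((1 - tailWtK pr entb d W) * A (W ∪ {b})) * m W =
      prob pr (coreLevel arcs s (insert a U) W) * closeB entb b A W * (entInd entb W * m W) := by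
    intro W _
    rw [closeB_of_sure_tail pr d b A hsureb W]
    unfold entInd
    ring
  have hinv : ∀ W, (fun W => entInd entb W * m W) (insert a W) =
      (fun W => entInd entb W * m W) W := by
    intro W
    simp only
    rw [hma W]
    unfold entInd
    congr 1
    apply if_congr _ rfl rfl
    constructor
    · rintro ⟨r, hr, hrW⟩
      rw [Finset.mem_insert] at hrW
      rcases hrW with rfl | hrW
      · exact absurd hr hae
      · exact ⟨r, hr, hrW⟩
    · rintro ⟨r, hr, hrW⟩
      exact ⟨r, hr, Finset.mem_insert_of_mem hrW⟩
  rw [Finset.sum_congr rfl step, h.sum_gen pr (closeB entb b A) (fun W => entInd entb W * m W) hinv]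
  rfl


/-- **Two level reductions, gate side, a marker constant in `a` and `b`.** -/
lemma two_level_G (h : OrTailK arcs s U ent c a) (hb : OrTailK arcs s (insert a U) entb d b)
    (hae : a ∉ entb) (hwe : w ∉ entb) (hba : b ≠ a)
    (pr : E → R) (hsureb : ∀ r ∈ entb, pr (d r) = 1) (A m : Finset V → R)
    (hmb : ∀ W, m (insert b W) = m W) (hma : ∀ W, m (insert a W) = m W) :
    ∑ W ∈ (insert b (insert a U)).powerset,
        prob pr (coreLevel arcs s (insert b (insert a U)) W) * A (starTarget a w W) * m W =
      ∑ W ∈ U.powerset, prob pr (coreLevel arcs s U W) *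
        gValK (closeB entb b A) pr ent c a w W * m W := by
  rw [hb.sum_gen pr (fun X => A (starTarget a w X)) m hmb]
  have step : ∀ W ∈ (insert a U).powerset, prob pr (coreLevel arcs s (insert a U) W) *
      (tailWtK pr entb d W * A (starTarget a w W) +
        (1 - tailWtK pr entb d W) * A (starTarget a w (W ∪ {b}))) * m W =
      prob pr (coreLevel arcs s (insert a U) W) *
        closeB entb b (fun X => A (starTarget a w X)) W * m W := by
    intro W _
    have := closeB_of_sure pr d b (fun X => A (starTarget a w X)) hsureb W
    beta_reduce at this
    rw [this]
  rw [Finset.sum_congr rfl step,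
    h.sum_gen pr (closeB entb b (fun X => A (starTarget a w X))) m hma]
  refine Finset.sum_congr rfl fun W hW => ?_
  have hWU : W ⊆ U := Finset.mem_powerset.1 hW
  have haW : a ∉ W := fun haW => h.a_notin (hWU haW)
  rw [closeB_star_of_notMem entb A haW hba, closeB_star_insert entb A hae hwe]
  rfl

/-- **Two level reductions, gate side, the marker at `b`** (times a marker constant in `a`, `b`). -/
lemma two_level_G_tail (h : OrTailK arcs s U ent c a)
    (hb : OrTailK arcs s (insert a U) entb d b) (hae : a ∉ entb) (hwe : w ∉ entb) (hba : b ≠ a)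
    (pr : E → R) (hsureb : ∀ r ∈ entb, pr (d r) = 1) (A g m : Finset V → R)
    (hg0 : ∀ W, b ∉ W → g W = 0) (hg1 : ∀ W, b ∉ W → g (insert b W) = m W)
    (hma : ∀ W, m (insert a W) = m W) :
    ∑ W ∈ (insert b (insert a U)).powerset,
        prob pr (coreLevel arcs s (insert b (insert a U)) W) * A (starTarget a w W) * g W =
      ∑ W ∈ U.powerset, prob pr (coreLevel arcs s U W) *
        gValK (closeB entb b A) pr ent c a w W * (entInd entb W * m W) := by
  rw [hb.sum_gen_tail pr (fun X => A (starTarget a w X)) g m hg0 hg1]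
  have step : ∀ W ∈ (insert a U).powerset, prob pr (coreLevel arcs s (insert a U) W) *
      ((1 - tailWtK pr entb d W) * A (starTarget a w (W ∪ {b}))) * m W =
      prob pr (coreLevel arcs s (insert a U) W) *
        closeB entb b (fun X => A (starTarget a w X)) W * (entInd entb W * m W) := by
    intro W _
    have := closeB_of_sure_tail pr d b (fun X => A (starTarget a w X)) hsureb W
    beta_reduce at this
    rw [this]
    unfold entInd
    ring
  have hinv : ∀ W, (fun W => entInd entb W * m W) (insert a W) =
      (fun W => entInd entb W * m W) W := by
    intro W
    simp only
    rw [hma W]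
    unfold entInd
    congr 1
    apply if_congr _ rfl rfl
    constructor
    · rintro ⟨r, hr, hrW⟩
      rw [Finset.mem_insert] at hrW
      rcases hrW with rfl | hrW
      · exact absurd hr hae
      · exact ⟨r, hr, hrW⟩
    · rintro ⟨r, hr, hrW⟩
      exact ⟨r, hr, Finset.mem_insert_of_mem hrW⟩
  rw [Finset.sum_congr rfl step,
    h.sum_gen pr (closeB entb b (fun X => A (starTarget a w X))) (fun W => entInd entb W * m W) hinv]
  refine Finset.sum_congr rfl fun W hW => ?_
  have hWU : W ⊆ U := Finset.mem_powerset.1 hW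
  have haW : a ∉ W := fun haW => h.a_notin (hWU haW)
  rw [closeB_star_of_notMem entb A haW hba, closeB_star_insert entb A hae hwe]
  rfl

end TwoLevel

end Summit.Ventures.PercRepro2.Coin
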